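import Summits.QuantumFields.YangMills.Theorems.PencilRigidityWeakCouplingHypercubicLimitCoordPerm
import Summits.QuantumFields.YangMills.Theorems.PencilRigidityWeakCouplingHypercubicLimitDecayTransfer
import Summits.QuantumFields.YangMills.Theorems.PencilRigidityWeakCouplingHypercubicLimitSeparatedDensity
import Summits.QuantumFields.YangMills.Theorems.LangevinControlUVOSLegsFromFemtoAndGapStubHypercubicTimeReflection
import Summits.QuantumFields.YangMills.Theorems.LangevinControlUVOSLegsFromFemtoAndGapStubHypercubicSignedPerm
import HarnessLib

/-!
# Crux `WeakCouplingHypercubicLimit` (stmt-QuantumFields-16120), line `Sketch`, r10: invariance of the summed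
plane-string limits under the signed permutations of the axes (stub `stub_signedPermOfPlaneLimits`, Z3b-SP)

Helper file of the lead (c4) for the r10 skeleton `Cruxes/WeakCouplingHypercubicLimit/Lines/Sketch.lean`.  Along a
`PlaneLimits r sch φ T` package with the `k`-uniform functional bound on `⁰𝒮`, the candidate one-field family
`planeSum T = Σ_q T n q` is invariant on `⁰𝒮` under `linActMulti R` for every linear isometry `R` of `ℝ⁴` mapping each
axis vector to a signed axis vector (the hyperoctahedral group `W(B₄)`):

* **time reflection** `Θ = thetaMulti 4` (`planeSum_thetaMulti`).  On the lattice the reflection is exact up to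
  slot-wise one-step shifts: the plane-string weights obey `W^q(θ̃_q x) = W^q(x)` (`torusMomentStr_plane_thetaSite`,
  `Θ`-invariance of Wilson's torus state under the bond reflection `t ↦ 1 − t`) and `θ(a x) = a θ̃_q x − d_q`,
  `‖d_{q,l}‖ ≤ a` (`smul_siteToE_thetaSite`).  For a COMPACTLY supported test function the lattice support and its
  reflection stay inside the torus box once `a_k L_k` is large, so reindexing the box sum by the involution `θ̃`
  gives the EXACT identity `planeDist k n q (ΘF) = planeDist k n q (τ_{d} F)` with the slot-shifted test function
  `τ_d F = SchwartzMap.compSubConstCLM ℂ d F` (`latticeDistStr_thetaMulti_eq`); for `F` supported at `δ`-SEPARATED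
  configurations the shifted functions stay in `⁰𝒮` (`2a < δ`) and tend to `F` in `𝓢`, so the moving-test-function
  lemma `planeDist_tendsto_of_tendsto` identifies the two limits (`planeSum_thetaMulti_separated`); general
  `F ∈ ⁰𝒮` by separated density (`separatedDensity_of_isOffDiagonal`) and continuity;
* **coordinate permutations**: landed `planeSum_linActMulti_coordPerm`;
* **generation**: `invariant_linActMulti_of_signedPerm` (OSLegs toolkit XXIV-b: an axis reflection is
  `P_{(0 i)} ∘ θ ∘ P_{(0 i)}`, a signed permutation is a sign matrix times a coordinate permutation).

Refs: OsterwalderSchrader1973 §2 (Euclidean covariance on `⁰𝒮`); OsterwalderSeiler1978 §§2–3; Wilson1974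
(hypercubic symmetry of the lattice action); GlimmJaffe1987 §6.1.
-/

noncomputable section

open scoped SchwartzMap BigOperators ComplexConjugate
open MeasureTheory Filter Topology
open Literature.MathematicalPhysics.QuantumFieldTheory Literature.MathematicalPhysics.QuantumLattice
open Literature.MathematicalPhysics.AQFT
open Literature.Probability.LatticeModels (box Site)
open Summit.QuantumFields.YangMills.Cruxes.HypercubicLimit.CouplingResponse
open Summit.QuantumFields.YangMills.Cruxes.OSLegsFromFemtoAndGap.DlrCollarTransfer (plane conn Decay RPPos ConnCS)
open Summit.QuantumFields.YangMills.Cruxes.OSLegsAtWeakCouplingC.Sketch (Separated)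
open Summit.QuantumFields.YangMills.Theorems.OSLegsFromFemtoAndGap

namespace Summit.QuantumFields.YangMills.Theorems.WeakCouplingHypercubicLimit.TraceNormColdPressure

/-! ### Small facts: reindexing by an involution, boxes, supports -/

/-- **Reindexing a finite sum by an involution** which keeps the non-vanishing set of the summand and its image
inside the index set: `Σ_{x ∈ S} g (σ x) = Σ_{y ∈ S} g y`. [folklore] -/
theorem sum_comp_involutive_eq {α M : Type*} [AddCommMonoid M] {σ : α → α} (hσ : Function.Involutive σ)
    (S : Finset α) (g : α → M) (hg : ∀ y, g y ≠ 0 → y ∈ S ∧ σ y ∈ S) :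
    ∑ x ∈ S, g (σ x) = ∑ y ∈ S, g y :=
  Finset.sum_bij_ne_zero (fun x _ _ => σ x) (fun x _ hx => (hg _ hx).1) (fun _ _ _ _ _ _ h => hσ.injective h)
    (fun y _ hne => ⟨σ y, (hg y hne).2, by rwa [hσ y], hσ y⟩) (fun _ _ _ => rfl)

/-- The reflected site `θ̃_q y` of a site of the box of half-side `N` lies in the box of half-side `N + 1`
(`(θ̃_q y)⁰ = 1 − y⁰ − [q temporal]`, spatial coordinates unchanged). [folklore] -/
theorem thetaSite_mem_box {N : ℕ} (q : Fin 4 × Fin 4) {y : Site 4} (hy : y ∈ box 4 N) :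
    thetaSite q y ∈ box 4 (N + 1) := by
  rw [Literature.Probability.LatticeModels.mem_box] at hy ⊢
  intro k
  by_cases hk : k = 0
  · subst hk
    rw [thetaSite_apply_zero]
    have h0 := hy 0
    split_ifs <;> push_cast <;> omega
  · rw [thetaSite_apply_of_ne q y hk]
    have h1 := hy k
    push_cast
    omega

/-- The slot-wise shifts `d_l = a (1 − [q_l temporal]) e₀` have norm at most `a`. [folklore] -/
theorem norm_thetaShiftPos_le {a : ℝ} (ha : 0 ≤ a) (q : Fin 4 × Fin 4) :
    ‖(a * (1 - if q.1 = 0 then 1 else 0)) • siteToE (Pi.single (0 : Fin 4) (1 : ℤ))‖ ≤ a := by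
  rw [norm_smul, OSLegsFromFemtoAndGap.norm_siteToE_single, mul_one, Real.norm_eq_abs]
  split_ifs <;> simp [abs_of_nonneg ha, ha]

/-- The support of a slot-shifted test function `w ↦ F (w − d)` with `‖d_l‖ ≤ a` lies in the ball of radius
`ρ + a` when `F` is supported in the ball of radius `ρ`. [folklore] -/
theorem tsupport_compSubConstCLM_subset_closedBall {n : ℕ} (F : 𝓢((Fin n → EuclideanSpace ℝ (Fin 4)), ℂ))
    {ρ a : ℝ} (ha : 0 ≤ a) (d : Fin n → EuclideanSpace ℝ (Fin 4)) (hd : ∀ l, ‖d l‖ ≤ a)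
    (hFρ : tsupport (F : (Fin n → EuclideanSpace ℝ (Fin 4)) → ℂ) ⊆ Metric.closedBall 0 ρ) :
    tsupport ((SchwartzMap.compSubConstCLM ℂ d F : 𝓢((Fin n → EuclideanSpace ℝ (Fin 4)), ℂ)) :
        (Fin n → EuclideanSpace ℝ (Fin 4)) → ℂ) ⊆ Metric.closedBall 0 (ρ + a) := by
  intro u hu
  have hw : u - d ∈ tsupport (F : (Fin n → EuclideanSpace ℝ (Fin 4)) → ℂ) :=
    tsupport_compSubConstCLM_subset_preimage_sub d F hu
  have h1 := hFρ hw
  rw [Metric.mem_closedBall, dist_zero_right] at h1 ⊢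
  have hdn : ‖d‖ ≤ a := (pi_norm_le_iff_of_nonneg ha).2 hd
  calc ‖u‖ = ‖u - d + d‖ := by rw [sub_add_cancel]
    _ ≤ ‖u - d‖ + ‖d‖ := norm_add_le _ _
    _ ≤ ρ + a := add_le_add h1 hdn

/-- A test function supported at pairwise distances `≥ δ > 0` is in `⁰𝒮` (its support misses the coincidence
locus). [folklore] -/
theorem isOffDiagonal_of_separated {n : ℕ} {F : 𝓢((Fin n → EuclideanSpace ℝ (Fin 4)), ℂ)} {δ : ℝ} (hδ : 0 < δ)
    (hFδ : tsupport (F : (Fin n → EuclideanSpace ℝ (Fin 4)) → ℂ) ⊆ Separated n δ) : IsOffDiagonal F := by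
  refine IsOffDiagonal.of_tsupport_subset fun u hu hc => ?_
  obtain ⟨i, j, hij, h⟩ := hc
  have hd := hFδ hu i j hij
  rw [h, dist_self] at hd
  linarith

/-- Slot-wise shifts of size `≤ a` keep a `δ`-separated support `(δ − 2a)`-separated. [folklore] -/
theorem tsupport_compSubConstCLM_subset_separated {n : ℕ} (F : 𝓢((Fin n → EuclideanSpace ℝ (Fin 4)), ℂ))
    {δ a : ℝ} (d : Fin n → EuclideanSpace ℝ (Fin 4)) (hd : ∀ l, ‖d l‖ ≤ a)
    (hFδ : tsupport (F : (Fin n → EuclideanSpace ℝ (Fin 4)) → ℂ) ⊆ Separated n δ) :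
    tsupport ((SchwartzMap.compSubConstCLM ℂ d F : 𝓢((Fin n → EuclideanSpace ℝ (Fin 4)), ℂ)) :
        (Fin n → EuclideanSpace ℝ (Fin 4)) → ℂ) ⊆ Separated n (δ - 2 * a) := by
  intro u hu i j hij
  have hw : u - d ∈ tsupport (F : (Fin n → EuclideanSpace ℝ (Fin 4)) → ℂ) :=
    tsupport_compSubConstCLM_subset_preimage_sub d F hu
  have h := hFδ hw i j hij
  simp only [Pi.sub_apply] at h
  have h2 := dist_sub_sub_le (u i) (d i) (u j) (d j)
  have h3 := dist_le_norm_add_norm (d i) (d j)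
  linarith [hd i, hd j]

/-! ### The exact lattice reflection identity -/

section LatticeFacts

variable {G : Type} [Group G] [TopologicalSpace G] [IsTopologicalGroup G] [CompactSpace G]
  [MeasurableSpace G] [BorelSpace G]

/-- **Exact time-reflection identity of the plane-string lattice distributions on compactly supported tests.**
For a test function supported in the ball of radius `ρ` and a torus box with `⌊(ρ + a)/a⌋ + 1 ≤ L`:
`Σ_x W^q(x) (ΘF)(a x) = Σ_x W^q(x) F(a x − d_q)` with the slot-wise shifts `d_{q,l} = a (1 − [q_l temporal]) e₀`
(`θ(a x_l) = a θ̃_{q_l} x_l − d_{q,l}` by `smul_siteToE_thetaSite`; reindex the box sum by the involution `θ̃`,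
which keeps the lattice supports inside the box, and use `W^q(θ̃ x) = W^q(x)`, `torusMomentStr_plane_thetaSite`).
[folklore] -/
theorem latticeDistStr_thetaMulti_eq (r : LatticeRep G) (β : ℝ) (L : ℕ) {a ρ : ℝ} (ha : 0 < a) {n : ℕ}
    (q : Fin n → Plane) (m : Fin n → ℝ) (F : 𝓢((Fin n → EuclideanSpace ℝ (Fin 4)), ℂ))
    (hFρ : tsupport (F : (Fin n → EuclideanSpace ℝ (Fin 4)) → ℂ) ⊆ Metric.closedBall 0 ρ)
    (hL : ⌊(ρ + a) / a⌋₊ + 1 ≤ L) :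
    latticeDistStr r.ρ β L a (fun i => (planeSpecies r (q i)).F) m (thetaMulti 4 F) =
      latticeDistStr r.ρ β L a (fun i => (planeSpecies r (q i)).F) m
        (SchwartzMap.compSubConstCLM ℂ
          (fun l => (a * (1 - if (q l).1.1 = 0 then 1 else 0)) • siteToE (Pi.single (0 : Fin 4) (1 : ℤ))) F) := by
  classical
  -- the shifts, the shifted test function, the weights, the involution
  set d : Fin n → EuclideanSpace ℝ (Fin 4) := fun l =>
    (a * (1 - if (q l).1.1 = 0 then 1 else 0)) • siteToE (Pi.single (0 : Fin 4) (1 : ℤ)) with hd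
  set H : 𝓢((Fin n → EuclideanSpace ℝ (Fin 4)), ℂ) := SchwartzMap.compSubConstCLM ℂ d F with hH
  set W : (Fin n → Site 4) → ℂ := fun x =>
    ((torusMomentStr r.ρ β L (fun i => (planeSpecies r (q i)).F) m x : ℝ) : ℂ) with hW
  set σ : (Fin n → Site 4) → (Fin n → Site 4) := fun x l => thetaSite (q l).1 (x l) with hσ
  have hσinv : Function.Involutive σ := fun x => funext fun l => thetaSite_thetaSite _ _
  have hWσ : ∀ x, W (σ x) = W x := fun x => by
    simp only [hW, hσ, planeSpecies_F]
    rw [torusMomentStr_plane_thetaSite r β L (fun i => (q i).2) m x]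
  set g : (Fin n → Site 4) → ℂ := fun y => W y * H (fun l => a • siteToE (y l)) with hg
  -- the reflected summand is the shifted summand at the reflected sites
  have hlhs : ∀ x : Fin n → Site 4, W x * thetaMulti 4 F (fun l => a • siteToE (x l)) = g (σ x) := fun x => by
    simp only [hg]
    rw [hWσ x, thetaMulti_apply, hH, SchwartzMap.compSubConstCLM_apply]
    congr 2
    funext l
    rw [Pi.sub_apply, hσ, hd]
    dsimp only
    rw [smul_siteToE_thetaSite, add_sub_cancel_right]
  -- support control: the shifted test function lives in the ball of radius `ρ + a`
  have hdn : ∀ l, ‖d l‖ ≤ a := fun l => norm_thetaShiftPos_le ha.le (q l).1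
  have hHρ := tsupport_compSubConstCLM_subset_closedBall F ha.le d hdn hFρ
  have hg0 : ∀ y, g y ≠ 0 → y ∈ Fintype.piFinset (fun _ : Fin n => box 4 L) ∧
      σ y ∈ Fintype.piFinset (fun _ : Fin n => box 4 L) := by
    intro y hy
    have hHy : H (fun l => a • siteToE (y l)) ≠ 0 := fun h => hy (by simp only [hg, h, mul_zero])
    have hmem := thermal_bookkeeping_mem_piFinset_box H ha hHρ hHy
    rw [Fintype.mem_piFinset] at hmem
    exact ⟨Fintype.mem_piFinset.2 fun l => Literature.Probability.LatticeModels.box_mono 4 (by omega) (hmem l),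
      Fintype.mem_piFinset.2 fun l =>
        Literature.Probability.LatticeModels.box_mono 4 hL (thetaSite_mem_box (q l).1 (hmem l))⟩
  rw [latticeDistStr_apply, latticeDistStr_apply]
  calc ∑ x ∈ Fintype.piFinset (fun _ : Fin n => box 4 L), W x * thetaMulti 4 F (fun l => a • siteToE (x l))
      = ∑ x ∈ Fintype.piFinset (fun _ : Fin n => box 4 L), g (σ x) := Finset.sum_congr rfl fun x _ => hlhs x
    _ = ∑ y ∈ Fintype.piFinset (fun _ : Fin n => box 4 L), g y := sum_comp_involutive_eq hσinv _ g hg0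
    _ = _ := rfl

/-- **The renormalised plane-string distribution of the reflected test function is that of the slot-shifted one**,
exactly, once the box is large compared to the support: `planeDist k n q (ΘF) = planeDist k n q (τ_{d_q} F)`
(the scalar `(c_k a_k⁴)ⁿ` is common). [folklore] -/
theorem planeDist_thetaMulti_eq (r : LatticeRep G) (sch : SpeciesScheme (YMSpecies G)) (k n : ℕ) (q : Fin n → Plane)
    (F : 𝓢((Fin n → EuclideanSpace ℝ (Fin 4)), ℂ)) {ρ : ℝ}
    (hFρ : tsupport (F : (Fin n → EuclideanSpace ℝ (Fin 4)) → ℂ) ⊆ Metric.closedBall 0 ρ)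
    (hL : ⌊(ρ + sch.a k) / sch.a k⌋₊ + 1 ≤ sch.L k) :
    planeDist r sch k n q (thetaMulti 4 F) =
      planeDist r sch k n q (SchwartzMap.compSubConstCLM ℂ
        (fun l => (sch.a k * (1 - if (q l).1.1 = 0 then 1 else 0)) • siteToE (Pi.single (0 : Fin 4) (1 : ℤ))) F) := by
  simp only [planeDist, FunLike.coe_smul, Pi.smul_apply]
  rw [latticeDistStr_thetaMulti_eq r (sch.β k) (sch.L k) (sch.a_pos k) q _ F hFρ hL]

end LatticeFacts

/-! ### Time-reflection invariance of the limit -/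

section Theta

variable {G : Type} [Group G] [TopologicalSpace G] [IsTopologicalGroup G] [CompactSpace G]
  [MeasurableSpace G] [BorelSpace G]
  (r : LatticeRep G) (sch : SpeciesScheme (YMSpecies G)) (φ : ℕ → ℕ) (hφ : StrictMono φ)
  (T : (n : ℕ) → (Fin n → Plane) → (𝓢((Fin n → EuclideanSpace ℝ (Fin 4)), ℂ) →L[ℂ] ℂ))
  (hUFB : UniformFunctionalBoundPlanes r sch) (hPL : PlaneLimits r sch φ T)

include hφ hUFB hPL

/-- **Time-reflection invariance of the limit on the separated compactly supported class.**  For `F` supported in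
the ball of radius `ρ ≥ 0` at `δ`-separated configurations: `planeSum T n (ΘF) = planeSum T n F` — both sides are
limits along `φ` of `Σ_q planeDist (φ k) n q (·)` (`PlaneLimits.tendsto_planeSum`, resp. the moving-test-function
lemma `planeDist_tendsto_of_tendsto` applied to the slot-shifted `τ_{d_{q,k}} F → F`, which stay in `⁰𝒮` once
`2a < δ`), and the two sequences agree for large `k` by the exact lattice identity `planeDist_thetaMulti_eq`.
[folklore] -/
theorem planeSum_thetaMulti_separated {n : ℕ} {F : 𝓢((Fin n → EuclideanSpace ℝ (Fin 4)), ℂ)} {ρ δ : ℝ}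
    (hδ : 0 < δ) (hρ : 0 ≤ ρ)
    (hFρ : tsupport (F : (Fin n → EuclideanSpace ℝ (Fin 4)) → ℂ) ⊆ Metric.closedBall 0 ρ)
    (hFδ : tsupport (F : (Fin n → EuclideanSpace ℝ (Fin 4)) → ℂ) ⊆ Separated n δ) :
    planeSum T n (thetaMulti 4 F) = planeSum T n F := by
  classical
  have ha0 : Tendsto (fun k => sch.a (φ k)) atTop (𝓝 0) := sch.tendsto_a.comp hφ.tendsto_atTop
  have haL : Tendsto (fun k => sch.a (φ k) * sch.L (φ k)) atTop atTop := sch.tendsto_L.comp hφ.tendsto_atTop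
  -- eventually the spacing is small and the box is large
  have hsmall : ∀ᶠ k in atTop, 2 * sch.a (φ k) < δ ∧ ⌊(ρ + sch.a (φ k)) / sch.a (φ k)⌋₊ + 1 ≤ sch.L (φ k) := by
    have h1 : ∀ᶠ k in atTop, sch.a (φ k) < min (δ / 2) 1 :=
      ha0.eventually (gt_mem_nhds (lt_min (by linarith) one_pos))
    have h2 : ∀ᶠ k in atTop, ρ + 2 ≤ sch.a (φ k) * sch.L (φ k) := haL.eventually (eventually_ge_atTop (ρ + 2))
    filter_upwards [h1, h2] with k hk1 hk2
    have ha := sch.a_pos (φ k)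
    obtain ⟨hkδ, hk1'⟩ := lt_min_iff.1 hk1
    refine ⟨by linarith, ?_⟩
    have hfl : (⌊(ρ + sch.a (φ k)) / sch.a (φ k)⌋₊ : ℝ) ≤ (ρ + sch.a (φ k)) / sch.a (φ k) :=
      Nat.floor_le (by positivity)
    have hq : (ρ + sch.a (φ k)) / sch.a (φ k) + 1 ≤ sch.L (φ k) := by
      rw [div_add_one ha.ne', div_le_iff₀ ha]
      nlinarith
    have h : ((⌊(ρ + sch.a (φ k)) / sch.a (φ k)⌋₊ + 1 : ℕ) : ℝ) ≤ sch.L (φ k) := by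
      push_cast
      linarith
    exact_mod_cast h
  -- the shifts and the moving test functions
  set d : ℕ → (Fin n → Plane) → Fin n → EuclideanSpace ℝ (Fin 4) := fun k q l =>
    (sch.a (φ k) * (1 - if (q l).1.1 = 0 then 1 else 0)) • siteToE (Pi.single (0 : Fin 4) (1 : ℤ)) with hd
  set H : ℕ → (Fin n → Plane) → 𝓢((Fin n → EuclideanSpace ℝ (Fin 4)), ℂ) := fun k q =>
    if 2 * sch.a (φ k) < δ then SchwartzMap.compSubConstCLM ℂ (d k q) F else F with hH
  have hFo : IsOffDiagonal F := isOffDiagonal_of_separated hδ hFδ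
  have hθFo : IsOffDiagonal (thetaMulti 4 F) := hFo.linActMulti _
  have hdn : ∀ k q l, ‖d k q l‖ ≤ sch.a (φ k) := fun k q l => norm_thetaShiftPos_le (sch.a_pos (φ k)).le (q l).1
  have hHoff : ∀ k q, IsOffDiagonal (H k q) := by
    intro k q
    simp only [hH]
    split_ifs with hk
    · exact isOffDiagonal_of_separated (δ := δ - 2 * sch.a (φ k)) (by linarith)
        (tsupport_compSubConstCLM_subset_separated F (d k q) (hdn k q) hFδ)
    · exact hFo
  have hdlim : ∀ q, Tendsto (fun k => d k q) atTop (𝓝 0) := by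
    intro q
    rw [tendsto_zero_iff_norm_tendsto_zero]
    refine squeeze_zero (fun k => norm_nonneg _) (fun k => ?_) ha0
    exact (pi_norm_le_iff_of_nonneg (sch.a_pos (φ k)).le).2 (hdn k q)
  have hHlim : ∀ q, Tendsto (fun k => H k q) atTop (𝓝 F) := by
    intro q
    have h1 : Tendsto (fun k => SchwartzMap.compSubConstCLM ℂ (d k q) F) atTop (𝓝 F) := by
      have h := ((continuous_compSubConstCLM ℂ F).tendsto 0).comp (hdlim q)
      rwa [SchwartzMap.compSubConstCLM_zero, ContinuousLinearMap.id_apply] at h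
    refine h1.congr' ?_
    filter_upwards [hsmall] with k hk
    simp only [hH, if_pos hk.1]
  -- the shifted sums converge to `planeSum T n F`
  have hsum : Tendsto (fun k => ∑ q : Fin n → Plane, planeDist r sch (φ k) n q (H k q)) atTop
      (𝓝 (planeSum T n F)) := by
    have h : Tendsto (fun k => ∑ q : Fin n → Plane, planeDist r sch (φ k) n q (H k q)) atTop
        (𝓝 (∑ q : Fin n → Plane, T n q F)) :=
      tendsto_finsetSum _ fun q _ =>
        planeDist_tendsto_of_tendsto G r sch φ T hUFB hPL n q (fun k => H k q) F (fun k => hHoff k q) hFo (hHlim q)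
    unfold planeSum
    rwa [FunLike.coe_sum, Finset.sum_apply]
  -- the reflected sums converge to `planeSum T n (ΘF)` and agree eventually with the shifted sums
  refine tendsto_nhds_unique (hPL.tendsto_planeSum _ hθFo) (hsum.congr' ?_)
  filter_upwards [hsmall] with k hk
  refine Finset.sum_congr rfl fun q _ => ?_
  rw [hH]
  dsimp only
  rw [if_pos hk.1]
  exact (planeDist_thetaMulti_eq r sch (φ k) n q F hFρ hk.2).symm

/-- **Time-reflection invariance of the limit on `⁰𝒮`**: `planeSum T n (ΘF) = planeSum T n F` for every off-diagonal
`F` — separated density (`separatedDensity_of_isOffDiagonal`, radii from `exists_radius`) + continuity of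
`planeSum T n` and of `Θ` on `𝓢`. [folklore] -/
theorem planeSum_thetaMulti (n : ℕ) (F : 𝓢((Fin n → EuclideanSpace ℝ (Fin 4)), ℂ)) (hF : IsOffDiagonal F) :
    planeSum T n (thetaMulti 4 F) = planeSum T n F := by
  obtain ⟨u, hcs, hsep, -, -, hlim⟩ := separatedDensity_of_isOffDiagonal n F hF
  have heq : ∀ m, planeSum T n (thetaMulti 4 (u m)) = planeSum T n (u m) := fun m => by
    obtain ⟨δ, hδ, hδs⟩ := hsep m
    obtain ⟨ρ, hρ, hρs⟩ := exists_radius (hcs m)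
    exact planeSum_thetaMulti_separated r sch φ hφ T hUFB hPL hδ hρ hρs hδs
  have h1 : Tendsto (fun m => planeSum T n (thetaMulti 4 (u m))) atTop (𝓝 (planeSum T n (thetaMulti 4 F))) :=
    (((planeSum T n).continuous.comp (thetaMulti 4).continuous).tendsto F).comp hlim
  have h2 : Tendsto (fun m => planeSum T n (u m)) atTop (𝓝 (planeSum T n F)) :=
    ((planeSum T n).continuous.tendsto F).comp hlim
  exact tendsto_nhds_unique (h1.congr heq) h2

end Theta

/-- `stub_signedPermOfPlaneLimits` (Z3b-SP, line `Sketch`, r10) — **invariance of the limit under every signed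
permutation of the axes on `⁰𝒮`** (the full hyperoctahedral group `W(B₄)`, in particular the det-1 ones of the crux
and the axis transpositions / time reflection consumed by E4): coordinate permutations act exactly
(`planeSum_linActMulti_coordPerm`), the time reflection up to slot-wise `O(a_k)` shifts of the base corners — exact on
the separated dense class, then density (`planeSum_thetaMulti`) —, and the two generate (`invariant_linActMulti_of_signedPerm`).
[folklore] -/
theorem stub_signedPermOfPlaneLimits :
    ∀ (G : Type) [Group G] [TopologicalSpace G] [IsTopologicalGroup G] [CompactSpace G]
      [MeasurableSpace G] [BorelSpace G] (r : LatticeRep G) (sch : SpeciesScheme (YMSpecies G))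
      (φ : ℕ → ℕ) (hφ : StrictMono φ)
      (T : (n : ℕ) → (Fin n → Plane) → (𝓢((Fin n → EuclideanSpace ℝ (Fin 4)), ℂ) →L[ℂ] ℂ)),
      UniformFunctionalBoundPlanes r sch → PlaneLimits r sch φ T →
        ∀ (n : ℕ) (R : EuclideanSpace ℝ (Fin 4) ≃ₗᵢ[ℝ] EuclideanSpace ℝ (Fin 4)),
          (∀ i : Fin 4, ∃ j : Fin 4, R (EuclideanSpace.single i 1) = EuclideanSpace.single j 1 ∨
            R (EuclideanSpace.single i 1) = -EuclideanSpace.single j 1) →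
          ∀ F : 𝓢((Fin n → EuclideanSpace ℝ (Fin 4)), ℂ), IsOffDiagonal F →
            planeSum T n (linActMulti R F) = planeSum T n F := by
  intro G _ _ _ _ _ _ r sch φ hφ T hUFB hPL n R hR F hF
  exact invariant_linActMulti_of_signedPerm (S₁ := planeSum T)
    (fun π n F hF => planeSum_linActMulti_coordPerm G r sch φ T hPL π n F hF)
    (fun n F hF => planeSum_thetaMulti r sch φ hφ T hUFB hPL n F hF) R hR n F hF

end Summit.QuantumFields.YangMills.Theorems.WeakCouplingHypercubicLimit.TraceNormColdPressure

end
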